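import Literature.NumberTheory.LocalFields.UnramifiedQuadraticNormFixedPoints      -- ★ p840580 (B-p10): `map_vCoord`, `map_uCoord`, the `R^σ`-coordinates `x = u(x) + v(x)·a`
import HarnessLib

/-!
# Mars' lattice lemma for an unramified quadratic extension of discrete valuation rings, σ-form: an `R^σ`-stable lattice `Λ ≤ R` containing `1` and a
# non-fixed element IS an order `R(j) = {x : σ x − x ∈ 𝔪^j}`, with `j` unique
(Flicker, *Elementary proof of the fundamental lemma for a unitary group* (1998), REMARK p. 84 (J. G. M. Mars' letter) = [F5] Lemma I.I.1; Serre, *Local Fields*, Ch. V §2)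

Topic `NumberTheory/LocalFields`, namespace `Literature.NumberTheory.LocalFields.UnramifiedQuadraticNorm` (= ★ `UnramifiedQuadraticNorm{FixedPoints,Fibres}`, ★
`UnramifiedQuadraticOrderUnitIndex`).  THEOREMS ONLY: no definition, no named fact, no instance, no notation, no `sorry`.  Cell `pub/hodgecm-mathlib`, F0∕P3a road
«D-N7-inert» COUNT programme (MAP v3 §2 (F3) «H-decompositions + order indices», LEAD F0P3a-plan (g9) T8-49 (C); F0P2-p06 (g5) HANDOFF-F3 1c13736d §REMAINING 1: «the
frame-free ENGINE of Prop. 6»).  HC_CM is proved only modulo the printed citations until rung 0 closes; nothing printed is a letter here — elementary DVR algebra.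

THE PRINT [Flicker1998UnitaryFL, p. 84 REMARK]: «Let `Λ` be a lattice in `V = E`. Then `R(Λ) = {x ∈ E ; xΛ ⊂ Λ}` is an order. The orders in `E` are `R_E(j) = R + π^j R_E`,
`j ≥ 0` … If `R(Λ) = R_E(j)`, then `Λ = z R_E(j)` for some `z ∈ E^×` … It follows immediately that `GL(V) = ⋃_{j ≥ 0} E^× d_j K`» — the decomposition behind
Prop. 6 (`H = ⊔_j T_H r_j (K_H × E¹)`).  IN-HOUSE, σ-INTRINSICALLY (no basis `1, w`, no uniformiser in the statement; ★ `UnramifiedQuadraticOrderUnitIndex`: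
`R_E(j) = R^σ + 𝔪^j = {x : σ x − x ∈ 𝔪^j}`): `R` a discrete valuation ring (model `R_E = 𝒪_w`) with an involution `σ` such that `σ a − a` is a unit for some `a`
(UNRAMIFIED), `R^σ` the fixed ring (model `R = 𝒪_v`), coordinates `x = u(x) + v(x)·a` with `v(x) = (σ x − x)(σ a − a)⁻¹`, `u(x) = x − v(x) a` both `σ`-fixed (★ B-p10).

* §1 `irreducible_of_mem_of_not_mem_sq`, **`exists_fixed_irreducible`** (a `σ`-FIXED uniformiser exists: `u(ϖ₀)` or `v(ϖ₀)`), `map_sub_self_pow_mul`.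
* §2 **`exists_forall_mem_iff_map_sub_self_mem_pow`** (MARS' LEMMA, normalised): for an additive subgroup `Λ ≤ R` which is `R^σ`-STABLE (`σ r = r → x ∈ Λ → r x ∈ Λ`),
  contains `1` and contains a NON-FIXED element: `∃ j, ∀ x, x ∈ Λ ↔ σ x − x ∈ 𝔪^j` — i.e. `Λ = R_E(j)`.  Proof: `V = v(Λ) ⊆ R^σ`; `v₀ = v(x₀)` of LEAST valuation (`Nat.find`);
  every `v ∈ V` is `v₀ q` with `q` automatically fixed; `1 ∈ Λ ⇒ R^σ ⊆ Λ ⇒ v₀ a = x₀ − u(x₀) ∈ Λ`; hence `Λ = R^σ ⊕ v₀ R^σ a = {x : v₀ ∣ v(x)} = {x : σ x − x ∈ 𝔪^{val v₀}}`.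
* §3 **`eq_of_forall_map_sub_self_mem_pow_iff`**: the exponent is UNIQUE (`{σx − x ∈ 𝔪^j} = {σx − x ∈ 𝔪^{j′}} ⇒ j = j′`; test elements `ϖ^n a`, `ϖ` fixed).
NOT here: the general lattice `Λ = ϖ^n w · R_E(j)` (reduction to the normalised case), the GROUP form of Prop. 6 on (F1)'s `K_H` (B-p17), the indices (★ p840757).

## References
* [Flicker1998UnitaryFL] Y. Z. Flicker, *Elementary proof of the fundamental lemma for a unitary group*, Canad. J. Math. 50 (1998), Prop. 6 p. 83 and REMARK p. 84.
* [Serre1979] J.-P. Serre, *Local Fields* (1979), Ch. V §2 Prop. 2–3.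
-/

set_option autoImplicit false

namespace Literature.NumberTheory.LocalFields.UnramifiedQuadraticNorm

open IsLocalRing

universe u

variable {R : Type u} [CommRing R] (σ : R →+* R)

/-! ## §1 A `σ`-fixed uniformiser -/

section Uniformiser

variable [IsDomain R] [IsDiscreteValuationRing R]

/-- In a DVR an element of `𝔪 ∖ 𝔪²` is irreducible (`x = ε ϖ^n` with `n = 1`). [cite: Serre1979, Ch. I §1] -/
theorem irreducible_of_mem_of_not_mem_sq {x : R} (h1 : x ∈ maximalIdeal R) (h2 : x ∉ maximalIdeal R ^ 2) : Irreducible x := by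
  obtain ⟨ϖ, hϖ⟩ := IsDiscreteValuationRing.exists_irreducible R
  have hm : maximalIdeal R = Ideal.span {ϖ} := (IsDiscreteValuationRing.irreducible_iff_uniformizer ϖ).1 hϖ
  have hx0 : x ≠ 0 := by rintro rfl; exact h2 (zero_mem _)
  obtain ⟨n, ε, hx⟩ := IsDiscreteValuationRing.eq_unit_mul_pow_irreducible hx0 hϖ
  have hn1 : n ≠ 0 := by
    rintro rfl
    rw [pow_zero, mul_one] at hx
    exact (IsLocalRing.mem_maximalIdeal _).1 h1 (hx ▸ Units.isUnit ε)
  have hn2 : n < 2 := by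
    by_contra hle
    apply h2
    rw [hm, Ideal.span_singleton_pow, Ideal.mem_span_singleton, hx]
    exact Dvd.dvd.mul_left (pow_dvd_pow ϖ (by omega)) _
  obtain rfl : n = 1 := by omega
  rw [hx, pow_one]
  exact (irreducible_units_mul ε).2 hϖ

variable (hσ : ∀ a, σ (σ a) = a) {a : R} (ha : IsUnit (σ a - a))

include hσ ha in
/-- **A `σ`-FIXED UNIFORMISER EXISTS** (unramified involution): for any uniformiser `ϖ₀ = u(ϖ₀) + v(ϖ₀)·a` both coordinates are `σ`-fixed elements of `𝔪`, and not both lie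
in `𝔪²`. [cite: Serre1979, Ch. V §2 Prop. 2] [cite: Flicker1998UnitaryFL, p. 84 REMARK] -/
theorem exists_fixed_irreducible : ∃ ϖ : R, Irreducible ϖ ∧ σ ϖ = ϖ := by
  obtain ⟨ϖ₀, hϖ₀⟩ := IsDiscreteValuationRing.exists_irreducible R
  have hm0 : ϖ₀ ∈ maximalIdeal R := by
    rw [(IsDiscreteValuationRing.irreducible_iff_uniformizer ϖ₀).1 hϖ₀]; exact Ideal.mem_span_singleton_self _
  have hσm : σ ϖ₀ ∈ maximalIdeal R := map_mem_maximalIdeal σ hσ ϖ₀ hm0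
  -- the coordinates of `ϖ₀`
  have hv : (σ ϖ₀ - ϖ₀) * ↑(ha.unit⁻¹) ∈ maximalIdeal R := Ideal.mul_mem_right _ _ (sub_mem hσm hm0)
  have hu : ϖ₀ - (σ ϖ₀ - ϖ₀) * ↑(ha.unit⁻¹) * a ∈ maximalIdeal R := sub_mem hm0 (Ideal.mul_mem_right _ _ hv)
  by_cases hv2 : (σ ϖ₀ - ϖ₀) * ↑(ha.unit⁻¹) ∈ maximalIdeal R ^ 2
  · refine ⟨_, irreducible_of_mem_of_not_mem_sq hu fun hu2 => ?_, map_uCoord σ hσ ha ϖ₀⟩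
    have : ϖ₀ ∈ maximalIdeal R ^ 2 := by
      have h := add_mem hu2 (Ideal.mul_mem_right a _ hv2)
      rwa [sub_add_cancel] at h
    rw [(IsDiscreteValuationRing.irreducible_iff_uniformizer ϖ₀).1 hϖ₀, Ideal.span_singleton_pow, Ideal.mem_span_singleton] at this
    obtain ⟨c, hc⟩ := this
    apply hϖ₀.not_isUnit
    refine IsUnit.of_mul_eq_one c ?_
    have h0 : ϖ₀ ≠ 0 := hϖ₀.ne_zero
    have : ϖ₀ * (ϖ₀ * c) = ϖ₀ * 1 := by rw [mul_one, ← mul_assoc, ← pow_two]; exact hc.symm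
    exact mul_left_cancel₀ h0 this
  · exact ⟨_, irreducible_of_mem_of_not_mem_sq hv hv2, map_vCoord σ hσ ha ϖ₀⟩

omit [IsDomain R] [IsDiscreteValuationRing R] in
include ha in
/-- `σ x − x = v(x)·(σ a − a)`. [cite: Serre1979, Ch. V §2 Prop. 2] -/
theorem map_sub_self_eq_vCoord_mul (x : R) : σ x - x = (σ x - x) * ↑(ha.unit⁻¹) * (σ a - a) := by
  rw [mul_assoc, ha.val_inv_mul, mul_one]

end Uniformiser

/-! ## §2 Mars' lattice lemma (normalised): `Λ = R_E(j) = {x : σ x − x ∈ 𝔪^j}` -/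

section Mars

variable [IsDomain R] [IsDiscreteValuationRing R] (hσ : ∀ a, σ (σ a) = a) {a : R} (ha : IsUnit (σ a - a))

include hσ ha in
/-- **MARS' LATTICE LEMMA (σ-form).**  `R` a DVR with an unramified involution `σ` (`σ a − a` a unit).  If an additive subgroup `Λ ≤ R` is stable under
multiplication by `σ`-FIXED elements, contains `1`, and contains an element NOT fixed by `σ`, then for a unique `j` (uniqueness: `eq_of_forall_map_sub_self_mem_pow_iff`)
`Λ = {x : σ x − x ∈ 𝔪^j} = R^σ + 𝔪^j = R_E(j)` — «the orders in `E` are `R_E(j) = R + π^j R_E`; if `R(Λ) = R_E(j)` then `Λ = z R_E(j)`», here with `z = 1`.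
[cite: Flicker1998UnitaryFL, p. 84 REMARK] [cite: Serre1979, Ch. V §2 Prop. 2] -/
theorem exists_forall_mem_iff_map_sub_self_mem_pow (Λ : AddSubgroup R) (hmul : ∀ r x, σ r = r → x ∈ Λ → r * x ∈ Λ) (h1 : (1 : R) ∈ Λ)
    (hnf : ∃ x ∈ Λ, σ x ≠ x) : ∃ j : ℕ, ∀ x, x ∈ Λ ↔ σ x - x ∈ maximalIdeal R ^ j := by
  classical
  obtain ⟨ϖ, hϖ⟩ := IsDiscreteValuationRing.exists_irreducible R
  have hm : maximalIdeal R = Ideal.span {ϖ} := (IsDiscreteValuationRing.irreducible_iff_uniformizer ϖ).1 hϖ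
  have hθ0 : (↑(ha.unit⁻¹) : R) ≠ 0 := Units.ne_zero _
  -- fixed elements lie in `Λ`
  have hfix : ∀ r, σ r = r → r ∈ Λ := fun r hr => by simpa using hmul r 1 hr h1
  -- the exponents of the `v`-coordinates of `Λ`
  have hP : ∃ n, ∃ x ∈ Λ, ∃ ε : Rˣ, (σ x - x) * ↑(ha.unit⁻¹) = ↑ε * ϖ ^ n := by
    obtain ⟨x, hx, hne⟩ := hnf
    have hv0 : (σ x - x) * ↑(ha.unit⁻¹) ≠ 0 := mul_ne_zero (sub_ne_zero.2 hne) hθ0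
    obtain ⟨n, ε, h⟩ := IsDiscreteValuationRing.eq_unit_mul_pow_irreducible hv0 hϖ
    exact ⟨n, x, hx, ε, h⟩
  obtain ⟨x₀, hx₀, ε₀, hv₀⟩ := Nat.find_spec hP
  set j := Nat.find hP with hj
  have hv₀0 : (σ x₀ - x₀) * ↑(ha.unit⁻¹) ≠ 0 := by rw [hv₀]; exact mul_ne_zero (Units.ne_zero _) (pow_ne_zero _ hϖ.ne_zero)
  -- `v₀ a ∈ Λ`
  have hv₀a : (σ x₀ - x₀) * ↑(ha.unit⁻¹) * a ∈ Λ := by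
    have h := Λ.sub_mem hx₀ (hfix _ (map_uCoord σ hσ ha x₀))
    rwa [sub_sub_cancel] at h
  refine ⟨j, fun x => ⟨fun hx => ?_, fun hx => ?_⟩⟩
  · -- `x ∈ Λ ⇒ ϖ^j ∣ v(x) ⇒ σ x − x ∈ 𝔪^j`
    rw [hm, Ideal.span_singleton_pow, Ideal.mem_span_singleton, map_sub_self_eq_vCoord_mul σ ha x]
    by_cases hvx : (σ x - x) * ↑(ha.unit⁻¹) = 0
    · rw [hvx, zero_mul]; exact dvd_zero _
    · obtain ⟨n, ε, hn⟩ := IsDiscreteValuationRing.eq_unit_mul_pow_irreducible hvx hϖ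
      have hjn : j ≤ n := Nat.find_min' hP ⟨x, hx, ε, hn⟩
      rw [hn]
      exact Dvd.dvd.mul_right (Dvd.dvd.mul_left (pow_dvd_pow ϖ hjn) _) _
  · -- `σ x − x ∈ 𝔪^j ⇒ v(x) = q v₀` with `q` fixed `⇒ x = u(x) + q (v₀ a) ∈ Λ`
    rw [hm, Ideal.span_singleton_pow, Ideal.mem_span_singleton] at hx
    obtain ⟨t, ht⟩ := hx
    set q : R := ((ε₀⁻¹ : Rˣ) : R) * t * ↑(ha.unit⁻¹) with hq
    have hε : ((ε₀⁻¹ : Rˣ) : R) * (ε₀ : R) = 1 := Units.inv_mul ε₀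
    have hvq : (σ x - x) * ↑(ha.unit⁻¹) = q * ((σ x₀ - x₀) * ↑(ha.unit⁻¹)) := by
      rw [ht, hv₀, hq]
      linear_combination -(t * ↑(ha.unit⁻¹) * ϖ ^ j) * hε
    have hqfix : σ q = q := by
      have h := map_vCoord σ hσ ha x
      rw [hvq, map_mul, map_vCoord σ hσ ha x₀] at h
      exact mul_right_cancel₀ hv₀0 h
    have hxdec : x = (x - (σ x - x) * ↑(ha.unit⁻¹) * a) + q * ((σ x₀ - x₀) * ↑(ha.unit⁻¹) * a) := by
      have : (σ x - x) * ↑(ha.unit⁻¹) * a = q * ((σ x₀ - x₀) * ↑(ha.unit⁻¹) * a) := by rw [hvq, mul_assoc]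
      rw [← this, sub_add_cancel]
    rw [hxdec]
    exact Λ.add_mem (hfix _ (map_uCoord σ hσ ha x)) (hmul q _ hqfix hv₀a)

/-! ## §3 Uniqueness of the exponent -/

include hσ ha in
/-- **The conductor exponent is unique**: `{x : σ x − x ∈ 𝔪^j} = {x : σ x − x ∈ 𝔪^{j′}} ⇒ j = j′` (test with `ϖ^n a`, `ϖ` a `σ`-fixed uniformiser:
`σ(ϖ^n a) − ϖ^n a = ϖ^n (σ a − a)` has valuation exactly `n`). [cite: Flicker1998UnitaryFL, p. 84 REMARK] [cite: Serre1979, Ch. V §2 Prop. 2] -/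
theorem eq_of_forall_map_sub_self_mem_pow_iff {j j' : ℕ} (h : ∀ x : R, σ x - x ∈ maximalIdeal R ^ j ↔ σ x - x ∈ maximalIdeal R ^ j') : j = j' := by
  obtain ⟨ϖ, hϖ, hσϖ⟩ := exists_fixed_irreducible σ hσ ha
  have hm : maximalIdeal R = Ideal.span {ϖ} := (IsDiscreteValuationRing.irreducible_iff_uniformizer ϖ).1 hϖ
  have key : ∀ n k : ℕ, σ (ϖ ^ n * a) - ϖ ^ n * a ∈ maximalIdeal R ^ k ↔ k ≤ n := by
    intro n k
    rw [map_mul, map_pow, hσϖ, ← mul_sub, hm, Ideal.span_singleton_pow, Ideal.mem_span_singleton, ha.dvd_mul_right,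
      pow_dvd_pow_iff hϖ.ne_zero hϖ.not_isUnit]
  have h1 := (key j j').1 ((h _).1 ((key j j).2 le_rfl))
  have h2 := (key j' j).1 ((h _).2 ((key j' j').2 le_rfl))
  omega

end Mars

/-! ## §4 Mars' lemma, general form: `Λ = z · R_E(j)` (ED. 2) -/

section MarsGeneral

variable [IsDomain R] [IsDiscreteValuationRing R] (hσ : ∀ a, σ (σ a) = a) {a : R} (ha : IsUnit (σ a - a))

include hσ ha in
/-- **MARS' LATTICE LEMMA, GENERAL FORM `Λ = z · R_E(j)`.**  `R` a DVR with an unramified involution `σ` (`σ a − a` a unit).  A nonzero additive subgroup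
`Λ ≤ R` stable under the `σ`-fixed ring `R^σ` and NOT contained in a line `z · R^σ` is `z · R_E(j)` for some `z ∈ Λ` (any element of least valuation) and a
(unique) `j`: `x ∈ Λ ⟺ x = z y` with `σ y − y ∈ 𝔪^j` — REMARK p. 84: «if `R(Λ) = R_E(j)` then `Λ = z R_E(j)` … it follows that `GL(V) = ⋃_{j ≥ 0} E^× d_j K`»,
the set-theoretic content of Prop. 6 `H = ⊔_j T_H r_j K_H`.  Reduction to §2: `z ∣ x` for all `x ∈ Λ` (DVR), and `Λ″ = {y : z y ∈ Λ}` contains `1`, is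
`R^σ`-stable and has a non-fixed element. [cite: Flicker1998UnitaryFL, p. 84 REMARK; Prop. 6 p. 83] [cite: Serre1979, Ch. V §2 Prop. 2] -/
theorem exists_forall_mem_iff_exists_map_sub_self_mem_pow_and_eq_mul (Λ : AddSubgroup R) (hmul : ∀ r x, σ r = r → x ∈ Λ → r * x ∈ Λ)
    (hne : ∃ x ∈ Λ, x ≠ 0) (hrk : ¬ ∃ z : R, ∀ x ∈ Λ, ∃ r, σ r = r ∧ x = z * r) :
    ∃ (z : R) (j : ℕ), z ∈ Λ ∧ z ≠ 0 ∧ ∀ x, x ∈ Λ ↔ ∃ y, σ y - y ∈ maximalIdeal R ^ j ∧ x = z * y := by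
  classical
  obtain ⟨ϖ, hϖ⟩ := IsDiscreteValuationRing.exists_irreducible R
  -- exponents of the nonzero elements of `Λ`; `z` of least valuation
  have hP : ∃ n, ∃ x ∈ Λ, ∃ ε : Rˣ, x = ↑ε * ϖ ^ n := by
    obtain ⟨x, hx, hx0⟩ := hne
    obtain ⟨n, ε, h⟩ := IsDiscreteValuationRing.eq_unit_mul_pow_irreducible hx0 hϖ
    exact ⟨n, x, hx, ε, h⟩
  obtain ⟨z, hz, ε₀, hzε⟩ := Nat.find_spec hP
  have hz0 : z ≠ 0 := by rw [hzε]; exact mul_ne_zero (Units.ne_zero _) (pow_ne_zero _ hϖ.ne_zero)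
  -- every element of `Λ` is a multiple of `z`
  have hdiv : ∀ x ∈ Λ, ∃ y, x = z * y := by
    intro x hx
    by_cases hx0 : x = 0
    · exact ⟨0, by rw [hx0, mul_zero]⟩
    obtain ⟨m, ε, hxε⟩ := IsDiscreteValuationRing.eq_unit_mul_pow_irreducible hx0 hϖ
    have hnm : Nat.find hP ≤ m := Nat.find_min' hP ⟨x, hx, ε, hxε⟩
    refine ⟨↑ε₀⁻¹ * ↑ε * ϖ ^ (m - Nat.find hP), ?_⟩
    have hpow : ϖ ^ m = ϖ ^ Nat.find hP * ϖ ^ (m - Nat.find hP) := by rw [← pow_add, Nat.add_sub_cancel' hnm]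
    have hε : (ε₀ : R) * ↑ε₀⁻¹ = 1 := Units.mul_inv ε₀
    rw [hxε, hzε, hpow]
    linear_combination -((ε : R) * ϖ ^ Nat.find hP * ϖ ^ (m - Nat.find hP)) * hε
  -- the normalised lattice `Λ″ = {y : z y ∈ Λ}`
  set Λ'' : AddSubgroup R := Λ.comap (AddMonoidHom.mulLeft z) with hΛ''
  have hmem'' : ∀ y, y ∈ Λ'' ↔ z * y ∈ Λ := fun y => Iff.rfl
  have hmul'' : ∀ r y, σ r = r → y ∈ Λ'' → r * y ∈ Λ'' := by
    intro r y hr hy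
    rw [hmem''] at hy ⊢
    rw [mul_left_comm]
    exact hmul r _ hr hy
  have h1'' : (1 : R) ∈ Λ'' := by rw [hmem'', mul_one]; exact hz
  have hnf'' : ∃ y ∈ Λ'', σ y ≠ y := by
    by_contra hall
    apply hrk
    refine ⟨z, fun x hx => ?_⟩
    obtain ⟨y, rfl⟩ := hdiv x hx
    refine ⟨y, ?_, rfl⟩
    by_contra hy
    exact hall ⟨y, (hmem'' y).2 hx, hy⟩
  obtain ⟨j, hj⟩ := exists_forall_mem_iff_map_sub_self_mem_pow σ hσ ha Λ'' hmul'' h1'' hnf''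
  refine ⟨z, j, hz, hz0, fun x => ⟨fun hx => ?_, ?_⟩⟩
  · obtain ⟨y, rfl⟩ := hdiv x hx
    exact ⟨y, (hj y).1 ((hmem'' y).2 hx), rfl⟩
  · rintro ⟨y, hy, rfl⟩
    exact (hmem'' y).1 ((hj y).2 hy)

end MarsGeneral

end Literature.NumberTheory.LocalFields.UnramifiedQuadraticNorm
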